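import Summits.BirchSwinnertonDyer.BirchSwinnertonDyer.Theorems.AdditiveBranchIMCMultLowerLambdaAdic
import Summits.BirchSwinnertonDyer.BirchSwinnertonDyer.Theorems.AdditiveBranchIMCMultLowerLambdaAdicOdd
import Summits.BirchSwinnertonDyer.BirchSwinnertonDyer.Theorems.AdditiveBranchIMCMultLowerCruxShape
import Summits.BirchSwinnertonDyer.Rank1Residual.Additive.ChiBranchLowerAscent
import Summits.BirchSwinnertonDyer.Rank1Residual.EisensteinPrimes
import Summits.BirchSwinnertonDyer.Rank1Residual.AdditivePotMult.TamagawaAtP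
import Literature.NumberTheory.EllipticCurves.BSDSelmerPConverseSerreProofs
import HarnessLib

/-!
# Route `AdditiveBranchIMC` (rung K1), crux `MultLower` (item `stmt-BirchSwinnertonDyer-19359`):
# on X4(M) ∩ {ρ_{E,p^∞} onto} in analytic rank `0` (every odd `p`) the crux and its Λ-adic child are ONE —
# `MissingLowerBoundAt W p ↔ ∀ twist models V, QuadraticBranchLowerDivisibilityAt V p`

Cell `bsd-addord`, seat `bsd-addord-k1-c4` (gen 2). Sequel of `AdditiveBranchIMCMultLowerCruxShape.lean`
(p426893: the crux BY NAME from six published facts + the Λ-adic child `QuadraticBranchLowerDivisibilityAt`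
at the multiplicative twist models + the rank-1 inputs) and `AdditiveBranchIMCMultLowerLambdaAdic{,Odd}.lean`
(p427322 / p427848: in rank `0` the `T = 0` input upgrades to the full branch main conjecture of `E` at
every tower-surjective multiplicative twist datum). HONEST FRAMING: every published input is an explicit
named-fact binder (`hK` Kato 17.4 (3) half-eigen reading, `hDel`/`hDelX` Delbourgo 1998 Prop. 4 in both
transcriptions, `hPal` Pal 2012 Thm. 3.2, GZK, modularity, `hmodD`); the Λ-adic child is NOT in print
and is NOT asserted; nothing booked; cell (M) stays CONSTRUCTION-shaped. THEOREMS ONLY.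

* §1 `quadraticBranchLowerDivisibilityAt_of_missingLowerBoundAt_rankZero_mult_towerSurj` — the
  ASCENT: on a pair of X4(M) (`p ≥ 5`, `r_an = 0`, `ρ_{E,p^∞}` tower-surjective) the crux's conclusion
  `MissingLowerBoundAt W p` implies the cell's conjecture `QuadraticBranchLowerDivisibilityAt V p` for
  EVERY globally minimal twist model `V` (`C • V^{(p*)} = W`): the eigen datum over `ℚ(μ_{p^∞})` ascends
  to a dual datum of `Sel_{p^∞}(E/ℚ_∞)` with the same characteristic ideal (b2b p07's
  `ChiEigenSelmerInDualData.toSelmerDualData`), where the LambdaAdic files give `char = (g_K)`,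
  `ι g_K = u·ϖ·B`; the good ordinary disjunct of the conjecture's binder is void because `ord_p j(E) < 0`.
* §2 `missingLowerBoundAt_iff_forall_quadraticBranchLower_classX4M_rankZero_towerSurj` and
  `…_of_surj` (tower from `Surj W p` by Serre's lifting lemma, `p ≥ 5`): **the iff** — (⟸) is p426893's
  `missingLowerBoundAt_rankZero_of_cellM_of_quadraticBranchLower` (no image hypothesis at all).
* §3 the three currencies (Λ-adic child ⟺ `T = 0` input) on X4(M). The REDUCIBLE rows X3♯(M) and the
  whole-cell form are the sibling file `AdditiveBranchIMCMultLowerLambdaAdicIffRed.lean`.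

So on X4(M) ∩ surj(p) ∩ `r_an = 0` ∩ `p ≥ 5` — the bulk of board row B2 (M) — the rank-`0` part of crux
19359, its `T = 0` input and its Λ-adic child (the ONE conjecture of the crux shape) are EQUIVALENT: the
proposed split of 19359 on `QuadraticBranchLowerDivisibilityAt` is lossless there.

References: K. Kato, Astérisque 295 (2004) Thm. 17.4 (3) [Kato2004Asterisque]; R. Greenberg, LNM 1716
(1999) §5 [GreenbergLNM1716]; J.-P. Serre, Abelian ℓ-adic representations (1968) IV §3.4 Lemma 3
[SerreAbelianLadic1968]; D. Delbourgo, Compositio Math. 113 (1998) Prop. 4 [Delbourgo1998]; V. Pal,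
Proc. AMS 140 (2012) Thm. 3.2 [Pal2012]; R. L. Miller, LMS J. Comput. Math. 14 (2011) Def. 1.1
[Miller2011LMS].
-/

set_option autoImplicit false
set_option linter.dupNamespace false

noncomputable section

open scoped Classical MatrixGroups ModularForm

open CongruenceSubgroup WeierstrassCurve NumberField IsDedekindDomain
  Literature.NumberTheory.EllipticCurves
  Literature.NumberTheory.EllipticCurves.ModularForms
  Literature.NumberTheory.EllipticCurves.Rank1Residual
  Literature.NumberTheory.EllipticCurves.Rank1Residual.Typed
  Literature.NumberTheory.GaloisRepresentations

namespace Summit.BirchSwinnertonDyer.BirchSwinnertonDyer.Theorems.AdditiveBranchIMCMultLowerLambdaAdic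

open Summit.BirchSwinnertonDyer.Rank1Residual.Additive
open Summit.BirchSwinnertonDyer.Rank1Residual.AdditivePotMult
open Summit.BirchSwinnertonDyer.BirchSwinnertonDyer.Theorems.AdditiveBranchIMCMultLower

variable {W : WeierstrassCurve ℚ} [W.IsElliptic] [W.IsGloballyMinimal] {p : ℕ} [hp : Fact p.Prime]

/-! ## §1 The ascent: the crux's conclusion ⟹ the Λ-adic child at every twist model -/

omit [W.IsGloballyMinimal] in
/-- A twist model `V` of a potentially multiplicative `W` (`ord_p j(W) < 0`) is not good ordinary at `p`
(`j` is a twist invariant and `ord_p j ≥ 0` at a good prime). [cite: SilvermanAEC2009, VII.5 Prop. 5.1, 5.5] -/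
theorem not_isOrdinaryAt_of_model_twist_of_padicValRat_j_neg
    (V : WeierstrassCurve ℚ) [V.IsElliptic] [V.IsGloballyMinimal] {d : ℚ} (hd : d ≠ 0)
    (hCW : ∃ C : VariableChange ℚ, C • V.quadraticTwist d = W) (hj : padicValRat p W.j < 0) :
    ¬ IsOrdinaryAt V p := by
  intro hord
  have hjV : padicValRat p V.j = 3 * padicValInt p (integralModelInt V).c₄ :=
    Summit.BirchSwinnertonDyer.Rank1Residual.EisensteinPrimes.padicValRat_j_eq_of_good V p hord.1
  rw [j_of_model_twist (W := V) hd hCW, hjV] at hj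
  exact absurd hj (not_lt.mpr (by positivity))

/-- **X4(M), `r_an = 0`, EVERY odd `p` (`p = 3` included), `p ≡ 1 (mod 4)`: Miller ⟺ `T = 0`** —
`MissingLowerBoundAt W p ↔ ChiBranchLowerLeadingTermAt W p`, the `p ∤ c_p` binder of the tree's
`missingLowerBoundAt_iff_cycLeadingTermDvdAt_of_potMult` being automatic on (M) (`c_p ∈ {1,2,4}`,
`ClassX4M.not_dvd_tamagawaNumberAt`). Bookkeeping; sharpens the LambdaAdic file's `p ≥ 5` version.
[cite: Delbourgo1998, Prop. 4 (p. 144), §2.2 Lemma (ii) (p. 139)] [cite: Pal2012, Thm. 3.2]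
[cite: SilvermanATAEC1994, IV.9.4 Steps 6–7] [cite: Miller2011LMS, Def. 1.1] -/
theorem missingLowerBoundAt_iff_chiBranchLowerLeadingTermAt_classX4M_rankZero_anyOdd
    (hDel : Delbourgo1998.prop4_rankZero_pow_dvd_constantCoeff)
    (hDelX : Delbourgo1998.prop4_rankZero_constantCoeff_eq_unit_mul_of_potMult)
    (hPal : Pal2012.thm32_sqrt_mul_realPeriodRat_twist_eq_of_prime_one_mod_four)
    (hGZK : rank_eq_analyticRank_of_analyticRank_le_one) (hmod : hasEntireLFunction_rat)
    (hmodD : nonempty_modularParametrizationData)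
    (hX : ClassX4M W p) (hp1 : p % 4 = 1) (hr : W.analyticRank = 0) :
    MissingLowerBoundAt W p ↔ ChiBranchLowerLeadingTermAt W p :=
  (missingLowerBoundAt_iff_cycLeadingTermDvdAt_of_potMult W p hDel hDelX hGZK hmod hX.1.1 hX.2.1 hX.2.2 hr
      (ClassX4M.not_dvd_tamagawaNumberAt hX)).trans
    ((cycLeadingTermDvdAt_iff_cycLowerLeadingTermAt W p).trans
      (ClassX4M.cycLowerLeadingTermAt_iff_chiBranchLower hPal hmod hmodD hX hp1))

/-- **Odd-parity twin, EVERY odd `p`** (`p ≡ 3 (mod 4)`, `p = 3` included):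
`MissingLowerBoundAt W p ↔ ChiBranchLowerLeadingTermOddAt W p` on X4(M) in analytic rank `0`.
[cite: Delbourgo1998, Prop. 4 (p. 144), §2.2 Lemma (ii) (p. 139)] [cite: SilvermanATAEC1994, IV.9.4 Steps 6–7]
[cite: Miller2011LMS, Def. 1.1] -/
theorem missingLowerBoundAt_iff_chiBranchLowerLeadingTermOddAt_classX4M_rankZero_anyOdd
    (hDel : Delbourgo1998.prop4_rankZero_pow_dvd_constantCoeff)
    (hDelX : Delbourgo1998.prop4_rankZero_constantCoeff_eq_unit_mul_of_potMult)
    (hGZK : rank_eq_analyticRank_of_analyticRank_le_one) (hmod : hasEntireLFunction_rat)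
    (hmodD : nonempty_modularParametrizationData)
    (hX : ClassX4M W p) (hp3 : p % 4 = 3) (hr : W.analyticRank = 0) :
    MissingLowerBoundAt W p ↔ ChiBranchLowerLeadingTermOddAt W p :=
  (missingLowerBoundAt_iff_cycLeadingTermDvdAt_of_potMult W p hDel hDelX hGZK hmod hX.1.1 hX.2.1 hX.2.2 hr
      (ClassX4M.not_dvd_tamagawaNumberAt hX)).trans
    ((cycLeadingTermDvdAt_iff_cycLowerLeadingTermAt W p).trans
      (ClassX4M.cycLowerLeadingTermAt_iff_chiBranchLowerOdd hmod hmodD hX hp3))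

/-- **ASCENT (X4(M), every odd `p`, `r_an = 0`, tower-surjective): the crux's conclusion `MissingLowerBoundAt W p`
implies the Λ-adic child `QuadraticBranchLowerDivisibilityAt V p` for EVERY globally minimal twist model
`V` of `W`.** Given the conjecture's binders `(K, F, κ, γ, f, B, D, ϖ)`: the good ordinary disjunct is void
(`ord_p j(W) < 0`), so `V` is multiplicative and `B` is the `a_p = ±1` branch series of the parity of
`(p−1)/2`; the eigen datum `D` ascends to a dual datum of `Sel_{p^∞}(W/ℚ_∞)` with the same characteristic
ideal; there the LambdaAdic files (`charIdeal_eq_span_kato_of_missingLowerBoundAt_rankZero_mult[_odd]`) give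
`char = (g_K)`, `ι g_K = u·ϖ·B`, whence `ι g = ι(k·u)·(ϖ·B)` for every `g ∈ char`. Facts: `hK`, `hDel`,
`hDelX`, `hPal`, `hGZK`, `hmod`, `hmodD`. [cite: Kato2004Asterisque, Thm. 17.4 (3) (p. 273)]
[cite: GreenbergLNM1716, §5 (PDF p. 143)] [cite: Delbourgo1998, Prop. 4 (p. 144)] [cite: Pal2012, Thm. 3.2] -/
theorem quadraticBranchLowerDivisibilityAt_of_missingLowerBoundAt_rankZero_mult_towerSurj
    (hK : Wuthrich2014.kato_halfEigenCharIdeal_dvd_cyclotomicPrime_of_surjective)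
    (hDel : Delbourgo1998.prop4_rankZero_pow_dvd_constantCoeff)
    (hDelX : Delbourgo1998.prop4_rankZero_constantCoeff_eq_unit_mul_of_potMult)
    (hPal : Pal2012.thm32_sqrt_mul_realPeriodRat_twist_eq_of_prime_one_mod_four)
    (hGZK : rank_eq_analyticRank_of_analyticRank_le_one) (hmod : hasEntireLFunction_rat)
    (hmodD : nonempty_modularParametrizationData)
    (hX : ClassX4M W p) (hr : W.analyticRank = 0)
    (htower : ∀ n : ℕ, W.HasSurjectiveModNGaloisRep (p ^ n : ℕ)) (hlow : MissingLowerBoundAt W p)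
    (V : WeierstrassCurve ℚ) [V.IsElliptic] [V.IsGloballyMinimal]
    (hVW : ∃ C : VariableChange ℚ, C • V.quadraticTwist ((-1) ^ (p / 2) * p : ℚ) = W) :
    QuadraticBranchLowerDivisibilityAt V p := by
  intro K _ _ _ F _ _ _ _ κ γ N _ f B hp2 hK2 hθ hB hκ hγ hcv hγK hγF hf D ϖ hϖ g hg
  have hpS : ((-1 : ℚ) ^ (p / 2) * p) ≠ 0 :=
    mul_ne_zero (pow_ne_zero _ (by norm_num)) (Nat.cast_ne_zero.mpr hp.out.ne_zero)
  obtain ⟨C, hC⟩ := hVW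
  -- `V` is multiplicative: the good ordinary disjunct is void on a potentially multiplicative `W`
  have hnord : ¬ IsOrdinaryAt V p :=
    not_isOrdinaryAt_of_model_twist_of_padicValRat_j_neg V hpS ⟨C, hC⟩ hX.2.2
  -- the ascent datum at `γ`
  obtain ⟨θ, hθ2⟩ := hθ
  have hθnr : θ ∉ Set.range (algebraMap ℚ K) := not_mem_range_algebraMap_of_sq_eq_pStar hθ2
  haveI : (V.quadraticTwist ((-1 : ℚ) ^ (p / 2) * p)).IsElliptic := V.isElliptic_quadraticTwist hpS
  let D' : W.SelmerDualData κ γ :=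
    ChiEigenSelmerInDualData.toSelmerDualData V K hK2 hθnr hθ2 p κ hC (galRange (K := ℚ) F)
      (isOpen_galRange F) (coprime_index_galRange_cyclotomic p F) hp2 hγK D
  have hg' : g ∈ D'.charIdeal := hg
  have hodd4 : p % 4 = 1 ∨ p % 4 = 3 := by
    obtain ⟨k, hk⟩ := hp.out.odd_of_ne_two hp2
    omega
  rcases hodd4 with hp1 | hp3
  · -- EVEN branch
    have heven : Even (p / 2) := ⟨p / 4, by omega⟩
    rw [if_pos heven] at hϖ
    have hCp : ∃ C : VariableChange ℚ, C • V.quadraticTwist (p : ℚ) = W :=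
      ⟨C, by rw [pStar_eq_self_of_mod_four_eq_one hp1] at hC; exact hC⟩
    -- the reduction type of `V` and the branch `B`
    obtain ⟨hV, hBmult⟩ : Mult V p ∧
        ((V.HasSplitMultiplicativeReductionAtPrime p ∧
            B = padicLFunctionPlusBranchMult f (1 : ℚ_[p]) (p / 2)) ∨
          (¬ V.HasSplitMultiplicativeReductionAtPrime p ∧
            B = padicLFunctionPlusBranchMult f (-1 : ℚ_[p]) (p / 2))) := by
      rcases hB with ⟨hord, -⟩ | ⟨hs, hB⟩ | ⟨hm, hns, hB⟩
      · exact absurd hord hnord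
      · exact ⟨hs.hasMultiplicativeReductionAtPrime, Or.inl ⟨hs, by rw [hB, if_pos heven]⟩⟩
      · exact ⟨hm, Or.inr ⟨hns, by rw [hB, if_pos heven]⟩⟩
    have hT0 : ChiBranchLowerLeadingTermAt W p :=
      (missingLowerBoundAt_iff_chiBranchLowerLeadingTermAt_classX4M_rankZero_anyOdd hDel hDelX hPal hGZK hmod
        hmodD hX hp1 hr).mp hlow
    obtain ⟨B₁, e, hB₁shape, -, gK, -, u, hchar, hιgK⟩ :=
      charIdeal_eq_span_kato_of_chiBranchLowerLeadingTerm_rankZero_mult hK hPal hmod hX.2.1 hr htower hT0 V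
        hp1 hCp hV hκ hγ hcv hf D' ϖ hϖ
    have hBB : B₁ = B := by
      rcases hBmult with ⟨hs, hB⟩ | ⟨hns, hB⟩ <;> rcases hB₁shape with ⟨hs₁, hB₁⟩ | ⟨hns₁, hB₁⟩
      · rw [hB, hB₁]
      · exact absurd hs hns₁
      · exact absurd hs₁ hns
      · rw [hB, hB₁]
    rw [hchar] at hg'
    obtain ⟨k, hk⟩ := Ideal.mem_span_singleton'.mp hg'
    refine ⟨k * PowerSeries.C (u : ℤ_[p]), ?_⟩
    have hιC : iwasawaToPowerSeries p (PowerSeries.C (u : ℤ_[p])) =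
        PowerSeries.C (((u : ℤ_[p]) : ℤ_[p]) : ℚ_[p]) := by
      rw [iwasawaToPowerSeries, PowerSeries.map_C]
      rfl
    rw [← hk, ← hBB]
    simp only [map_mul, hιgK, hιC]
    ring
  · -- ODD branch
    have hodd : ¬ Even (p / 2) := by rw [Nat.not_even_iff_odd]; exact ⟨p / 4, by omega⟩
    rw [if_neg hodd] at hϖ
    have hCp : ∃ C : VariableChange ℚ, C • V.quadraticTwist (-(p : ℚ)) = W :=
      ⟨C, by rw [pStar_eq_neg_of_mod_four_eq_three hp3] at hC; exact hC⟩
    obtain ⟨hV, hBmult⟩ : Mult V p ∧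
        ((V.HasSplitMultiplicativeReductionAtPrime p ∧
            B = padicLFunctionMinusBranchMult f (1 : ℚ_[p]) (p / 2)) ∨
          (¬ V.HasSplitMultiplicativeReductionAtPrime p ∧
            B = padicLFunctionMinusBranchMult f (-1 : ℚ_[p]) (p / 2))) := by
      rcases hB with ⟨hord, -⟩ | ⟨hs, hB⟩ | ⟨hm, hns, hB⟩
      · exact absurd hord hnord
      · exact ⟨hs.hasMultiplicativeReductionAtPrime, Or.inl ⟨hs, by rw [hB, if_neg hodd]⟩⟩
      · exact ⟨hm, Or.inr ⟨hns, by rw [hB, if_neg hodd]⟩⟩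
    have hT0 : ChiBranchLowerLeadingTermOddAt W p :=
      (missingLowerBoundAt_iff_chiBranchLowerLeadingTermOddAt_classX4M_rankZero_anyOdd hDel hDelX hGZK hmod
        hmodD hX hp3 hr).mp hlow
    obtain ⟨B₁, e, hB₁shape, -, gK, -, u, hchar, hιgK⟩ :=
      charIdeal_eq_span_kato_of_chiBranchLowerLeadingTermOdd_rankZero_mult hK hmod hX.2.1 hr htower hT0 V
        hp3 hCp hV hκ hγ hcv hf D' ϖ hϖ
    have hBB : B₁ = B := by
      rcases hBmult with ⟨hs, hB⟩ | ⟨hns, hB⟩ <;> rcases hB₁shape with ⟨hs₁, hB₁⟩ | ⟨hns₁, hB₁⟩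
      · rw [hB, hB₁]
      · exact absurd hs hns₁
      · exact absurd hs₁ hns
      · rw [hB, hB₁]
    rw [hchar] at hg'
    obtain ⟨k, hk⟩ := Ideal.mem_span_singleton'.mp hg'
    refine ⟨k * PowerSeries.C (u : ℤ_[p]), ?_⟩
    have hιC : iwasawaToPowerSeries p (PowerSeries.C (u : ℤ_[p])) =
        PowerSeries.C (((u : ℤ_[p]) : ℤ_[p]) : ℚ_[p]) := by
      rw [iwasawaToPowerSeries, PowerSeries.map_C]
      rfl
    rw [← hk, ← hBB]
    simp only [map_mul, hιgK, hιC]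
    ring

/-! ## §2 The iff: on X4(M) ∩ surj(p) ∩ `r_an = 0` ∩ `p ≥ 5` the crux and its Λ-adic child coincide -/

/-- **X4(M), every odd `p`, `r_an = 0`, `ρ_{E,p^∞}` tower-surjective:
`MissingLowerBoundAt W p ↔ ∀ twist models V, QuadraticBranchLowerDivisibilityAt V p`.** (⟹) is §1 (Kato
`hK`, Delbourgo `hDel`/`hDelX`, Pal, GZK, modularity, `hmodD`); (⟸) is the crux shape's rank-`0` per-pair
consumer `missingLowerBoundAt_rankZero_of_cellM_of_quadraticBranchLower` (no image hypothesis). On these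
rows the rank-`0` lower half of `BSD(E,p)` and the Skinner–Urban containment on the `ω^{(p−1)/2}`-component
of the `p`-multiplicative newform are the SAME problem. [cite: Kato2004Asterisque, Thm. 17.4 (3) (p. 273)]
[cite: Delbourgo1998, Prop. 4 (p. 144), §2.2 Lemma (ii) (p. 139)] [cite: Pal2012, Thm. 3.2]
[cite: Miller2011LMS, Def. 1.1] -/
theorem missingLowerBoundAt_iff_forall_quadraticBranchLower_classX4M_rankZero_towerSurj
    (hK : Wuthrich2014.kato_halfEigenCharIdeal_dvd_cyclotomicPrime_of_surjective)
    (hDel : Delbourgo1998.prop4_rankZero_pow_dvd_constantCoeff)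
    (hDelX : Delbourgo1998.prop4_rankZero_constantCoeff_eq_unit_mul_of_potMult)
    (hPal : Pal2012.thm32_sqrt_mul_realPeriodRat_twist_eq_of_prime_one_mod_four)
    (hGZK : rank_eq_analyticRank_of_analyticRank_le_one) (hmod : hasEntireLFunction_rat)
    (hmodD : nonempty_modularParametrizationData)
    (hX : ClassX4M W p) (hr : W.analyticRank = 0)
    (htower : ∀ n : ℕ, W.HasSurjectiveModNGaloisRep (p ^ n : ℕ)) :
    MissingLowerBoundAt W p ↔
      ∀ (V : WeierstrassCurve ℚ) [V.IsElliptic] [V.IsGloballyMinimal],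
        (∃ C : VariableChange ℚ, C • V.quadraticTwist ((-1) ^ (p / 2) * p : ℚ) = W) →
          QuadraticBranchLowerDivisibilityAt V p :=
  ⟨fun hlow V _ _ hVW ↦
      quadraticBranchLowerDivisibilityAt_of_missingLowerBoundAt_rankZero_mult_towerSurj hK hDel hDelX hPal
        hGZK hmod hmodD hX hr htower hlow V hVW,
    fun hΛ ↦ missingLowerBoundAt_rankZero_of_cellM_of_quadraticBranchLower hDelX hPal hGZK hmod hmodD
      ((N10.cellM_iff_classX3M_or_classX4M W p).mpr (Or.inr hX)) hr hΛ⟩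

/-- **The same iff with the tower discharged from mod-`p` surjectivity** (Serre's lifting lemma, `p ≥ 5`,
tree theorem `serre_hasSurjectiveModNGaloisRep_pow_holds`): on X4(M) ∩ surj(p) ∩ `r_an = 0` ∩ `p ≥ 5`,
`MissingLowerBoundAt W p ↔ ∀ twist models V, QuadraticBranchLowerDivisibilityAt V p`.
[cite: SerreAbelianLadic1968, IV §3.4 Lemma 3] [cite: Kato2004Asterisque, Thm. 17.4 (3) (p. 273)]
[cite: Delbourgo1998, Prop. 4 (p. 144)] [cite: Miller2011LMS, Def. 1.1] -/
theorem missingLowerBoundAt_iff_forall_quadraticBranchLower_classX4M_rankZero_of_surj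
    (hK : Wuthrich2014.kato_halfEigenCharIdeal_dvd_cyclotomicPrime_of_surjective)
    (hDel : Delbourgo1998.prop4_rankZero_pow_dvd_constantCoeff)
    (hDelX : Delbourgo1998.prop4_rankZero_constantCoeff_eq_unit_mul_of_potMult)
    (hPal : Pal2012.thm32_sqrt_mul_realPeriodRat_twist_eq_of_prime_one_mod_four)
    (hGZK : rank_eq_analyticRank_of_analyticRank_le_one) (hmod : hasEntireLFunction_rat)
    (hmodD : nonempty_modularParametrizationData)
    (hX : ClassX4M W p) (hp5 : 5 ≤ p) (hr : W.analyticRank = 0) (hsurj : Surj W p) :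
    MissingLowerBoundAt W p ↔
      ∀ (V : WeierstrassCurve ℚ) [V.IsElliptic] [V.IsGloballyMinimal],
        (∃ C : VariableChange ℚ, C • V.quadraticTwist ((-1) ^ (p / 2) * p : ℚ) = W) →
          QuadraticBranchLowerDivisibilityAt V p :=
  missingLowerBoundAt_iff_forall_quadraticBranchLower_classX4M_rankZero_towerSurj hK hDel hDelX hPal hGZK
    hmod hmodD hX hr (serre_hasSurjectiveModNGaloisRep_pow_holds W p hp5 hsurj)

/-! ## §3 The three currencies agree: Λ-adic child ⟺ `T = 0` input (⟺ Miller), both parities -/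

/-- **X4(M), every odd `p`, `p ≡ 1 (mod 4)`, `r_an = 0`, tower-surjective: the Λ-adic child and the
`T = 0` input are ONE statement** — `(∀ twist models V, QuadraticBranchLowerDivisibilityAt V p) ↔
ChiBranchLowerLeadingTermAt W p` (both sides ⟺ `MissingLowerBoundAt W p` by §2 and the LambdaAdic file's
bookkeeping iff). [cite: Kato2004Asterisque, Thm. 17.4 (3) (p. 273)] [cite: Delbourgo1998, Prop. 4 (p. 144)]
[cite: Pal2012, Thm. 3.2] [cite: MazurTateTeitelbaum1986Invent, §I.14] -/
theorem forall_quadraticBranchLower_iff_chiBranchLowerLeadingTermAt_classX4M_rankZero_towerSurj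
    (hK : Wuthrich2014.kato_halfEigenCharIdeal_dvd_cyclotomicPrime_of_surjective)
    (hDel : Delbourgo1998.prop4_rankZero_pow_dvd_constantCoeff)
    (hDelX : Delbourgo1998.prop4_rankZero_constantCoeff_eq_unit_mul_of_potMult)
    (hPal : Pal2012.thm32_sqrt_mul_realPeriodRat_twist_eq_of_prime_one_mod_four)
    (hGZK : rank_eq_analyticRank_of_analyticRank_le_one) (hmod : hasEntireLFunction_rat)
    (hmodD : nonempty_modularParametrizationData)
    (hX : ClassX4M W p) (hp1 : p % 4 = 1) (hr : W.analyticRank = 0)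
    (htower : ∀ n : ℕ, W.HasSurjectiveModNGaloisRep (p ^ n : ℕ)) :
    (∀ (V : WeierstrassCurve ℚ) [V.IsElliptic] [V.IsGloballyMinimal],
        (∃ C : VariableChange ℚ, C • V.quadraticTwist ((-1) ^ (p / 2) * p : ℚ) = W) →
          QuadraticBranchLowerDivisibilityAt V p) ↔ ChiBranchLowerLeadingTermAt W p :=
  (missingLowerBoundAt_iff_forall_quadraticBranchLower_classX4M_rankZero_towerSurj hK hDel hDelX hPal hGZK
      hmod hmodD hX hr htower).symm.trans
    (missingLowerBoundAt_iff_chiBranchLowerLeadingTermAt_classX4M_rankZero_anyOdd hDel hDelX hPal hGZK hmod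
      hmodD hX hp1 hr)

/-- **Odd-parity twin** (`p ≡ 3 (mod 4)`, `p = 3` included): `(∀ twist models V,
QuadraticBranchLowerDivisibilityAt V p) ↔ ChiBranchLowerLeadingTermOddAt W p` on X4(M) ∩ tower-surj ∩ `r_an = 0`.
[cite: Kato2004Asterisque, Thm. 17.4 (3) (p. 273)] [cite: Delbourgo1998, Prop. 4 (p. 144)]
[cite: MazurTateTeitelbaum1986Invent, §I.14] -/
theorem forall_quadraticBranchLower_iff_chiBranchLowerLeadingTermOddAt_classX4M_rankZero_towerSurj
    (hK : Wuthrich2014.kato_halfEigenCharIdeal_dvd_cyclotomicPrime_of_surjective)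
    (hDel : Delbourgo1998.prop4_rankZero_pow_dvd_constantCoeff)
    (hDelX : Delbourgo1998.prop4_rankZero_constantCoeff_eq_unit_mul_of_potMult)
    (hPal : Pal2012.thm32_sqrt_mul_realPeriodRat_twist_eq_of_prime_one_mod_four)
    (hGZK : rank_eq_analyticRank_of_analyticRank_le_one) (hmod : hasEntireLFunction_rat)
    (hmodD : nonempty_modularParametrizationData)
    (hX : ClassX4M W p) (hp3 : p % 4 = 3) (hr : W.analyticRank = 0)
    (htower : ∀ n : ℕ, W.HasSurjectiveModNGaloisRep (p ^ n : ℕ)) :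
    (∀ (V : WeierstrassCurve ℚ) [V.IsElliptic] [V.IsGloballyMinimal],
        (∃ C : VariableChange ℚ, C • V.quadraticTwist ((-1) ^ (p / 2) * p : ℚ) = W) →
          QuadraticBranchLowerDivisibilityAt V p) ↔ ChiBranchLowerLeadingTermOddAt W p :=
  (missingLowerBoundAt_iff_forall_quadraticBranchLower_classX4M_rankZero_towerSurj hK hDel hDelX hPal hGZK
      hmod hmodD hX hr htower).symm.trans
    (missingLowerBoundAt_iff_chiBranchLowerLeadingTermOddAt_classX4M_rankZero_anyOdd hDel hDelX hGZK hmod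
      hmodD hX hp3 hr)

end Summit.BirchSwinnertonDyer.BirchSwinnertonDyer.Theorems.AdditiveBranchIMCMultLowerLambdaAdic

end
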